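import Summits.MatrixMultiplication.MatrixMultiplication.Theorems.SaturationLadderHeightCeiling
import HarnessLib

/-!
# Route `SaturationLadder` on Strassen's spectrum, XI: the CELL of a violator (height × aspect × darkness)

decomp-mm lens 1 «grading / quantitative ladder», gen 46, kernel K46-C (chain file 11, companion of files 9/10
`SaturationLadderHeightCeiling` / `SaturationLadderClauseGerm`).  Def-free, sorry-free support beneath the deciding crux
`SubexpSaturation` (stmt-MatrixMultiplication-25909) of `route-MatrixMultiplication-SaturationLadder`; cut of record
UNCHANGED.  Notation as in files 7–10: `θ = specMMPoint K φ`, darkness `d = θ₀+θ₁+θ₂−2`, height `θ₁`, depth `ε₂ = 1−θ₂`,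
`u = log(θ₁/ε₂)`; the clause `(t, R)` reads `t·θ₁ ≤ (1−θ₀) + R·ε₂`; the crux is the family `R = exp(c/(1−t))`, `c > 0`;
write `s = 1−t`, so `log R = c/s`.

The three coordinates of a would-be violator of the clause `(t, e^{c/s})`, `t ∈ [t₁,1)`, each lie in an explicit CELL:
* §1 ★★ `violator_cell` (every field, under the modulus law of a rate `c' > 0` beyond `u₀`):
  ASPECT `θ₁·e^{−c'/s} < ε₂ < θ₁·e^{−c/s}` (i.e. `ε₂/θ₁ ∈ (R^{−c'/c}, R^{−1})`) and DARKNESS `s·θ₁ < d < (c'/c)·s·θ₁`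
  (i.e. `d·log R/θ₁ ∈ (c, c')`): deep by the roof computation, not deeper and not darker by the law.  As `c ↑ c'` both
  cells shrink to points — the first clauses a rate-`c'` law does not decide can only fail at points of aspect
  `R^{−1−o(1)}` and darkness `(c'+o(1))·θ₁/log R`.
* §2 ★★ `violator_cell_record` (over `ℂ`, all certificates of record): for every `c > 0`, `c' > c₂ = (5 log(5/4)+3 log 2)/3`
  (file 3's law) and `t ∈ [t₁(c,c'),1)`: HEIGHT `0 < θ₁ < R^{−13/29}` (file 9 + route `FarEdgeDescent`'s `RateBeyond (13/29)`),
  ASPECT `ε₂/θ₁ ∈ (R^{−c'/c}, R^{−1})`, DARKNESS `d/(sθ₁) ∈ (1, c'/c)`.  ★ `no_violator_of_le` : under a rate-`c'` law with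
  `c' ≤ c` the cells are empty — the clause `(t, e^{c/s})` holds near `t = 1` (monotone form of file 9's exact-rate lemma).

Nothing here proves `ω = 2` or an open item; no definitions (gate rule D-0009).  [cite: Strassen1988, Thm. 3.8]
[cite: LottiRomani1983, Prop. 4.1] [cite: CoppersmithWinograd1990, §8] [cite: Pan1984, Thm. 17.1]
[cite: AlmanLi2026, Proposition 4.2]
-/

set_option linter.dupNamespace false

noncomputable section

namespace Summit.MatrixMultiplication.MatrixMultiplication.Theorems.SaturationLadderViolatorCell

open Literature.Computability.AlgebraicComplexity
open Summit.MatrixMultiplication.MatrixMultiplication.Theses.SaturationLadder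
open Summit.MatrixMultiplication.MatrixMultiplication.Theorems.SaturationLadderCornerModulus
open Summit.MatrixMultiplication.MatrixMultiplication.Theorems.SaturationLadderGaugeConeClasses
  (classCeiling_pos)
open Summit.MatrixMultiplication.MatrixMultiplication.Theorems.SaturationLadderHeightCeiling
open Summit.MatrixMultiplication.MatrixMultiplication.Theorems.FarEdgeDescentTowerLimit
  (rateBeyond_of_le_thirteen_twentyNinths)

variable {K : Type} [Field K]

/-! ## §1 The aspect and darkness cells under a modulus law (every field) -/

/-- ★★ **THE VIOLATOR'S CELL** (every field): under the corner modulus law of a rate `c' > 0` beyond `u₀`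
(`θ₂ < 1`, `u ≥ u₀ ⟹ d·u ≤ c'·θ₁`), for every `c > 0` there is `t₁ < 1` such that every universal `φ` violating the
clause `(t, exp(c/(1−t)))`, `t ∈ [t₁,1)`, has `θ₁ > 0`, ASPECT `θ₁·exp(−c'/(1−t)) < 1−θ₂ < θ₁·exp(−c/(1−t))` and
DARKNESS `(1−t)·θ₁ < d < (c'/c)·(1−t)·θ₁`.  (Deep and dark: the roof computation, file 9; not deeper, not darker: the
law at the point, whose log-aspect exceeds `c/(1−t) ≥ u₀`.) [cite: Strassen1988, Thm. 3.8] [cite: CoppersmithWinograd1990, §8] -/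
theorem violator_cell {c' : ℝ} (hc'0 : 0 < c')
    (hlaw : ∃ u₀ : ℝ, ∀ F : SpectralMap K, IsUniversalSpectralPoint K F → specMMPoint K F 2 < 1 →
      u₀ ≤ Real.log (specMMPoint K F 1 / (1 - specMMPoint K F 2)) →
        (specMMPoint K F 0 + specMMPoint K F 1 + specMMPoint K F 2 - 2) *
            Real.log (specMMPoint K F 1 / (1 - specMMPoint K F 2)) ≤ c' * specMMPoint K F 1)
    {c : ℝ} (hc : 0 < c) :
    ∃ t₁ : ℝ, t₁ < 1 ∧ ∀ t : ℝ, t₁ ≤ t → t < 1 → ∀ F : SpectralMap K, IsUniversalSpectralPoint K F →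
      ¬ (t * specMMPoint K F 1 ≤
          (1 - specMMPoint K F 0) + Real.exp (c / (1 - t)) * (1 - specMMPoint K F 2)) →
        0 < specMMPoint K F 1 ∧
          specMMPoint K F 1 * Real.exp (-(c' / (1 - t))) < 1 - specMMPoint K F 2 ∧
          1 - specMMPoint K F 2 < specMMPoint K F 1 * Real.exp (-(c / (1 - t))) ∧
          (1 - t) * specMMPoint K F 1 < specMMPoint K F 0 + specMMPoint K F 1 + specMMPoint K F 2 - 2 ∧
          specMMPoint K F 0 + specMMPoint K F 1 + specMMPoint K F 2 - 2 <
            c' / c * ((1 - t) * specMMPoint K F 1) := by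
  obtain ⟨u₀, hu₀⟩ := hlaw
  have hU : 0 < max u₀ 1 := lt_of_lt_of_le one_pos (le_max_right _ _)
  have hU₀ : u₀ ≤ max u₀ 1 := le_max_left _ _
  have hcU : 0 < c / (2 * max u₀ 1) := div_pos hc (by positivity)
  refine ⟨1 - c / (2 * max u₀ 1), by linarith, fun t ht ht1 F hF hnot => ?_⟩
  obtain ⟨hlt2, hθ1, hdeep, hu, hdark⟩ := violator_pointwise hF hc ht1 hnot
  have hs : 0 < 1 - t := by linarith
  have hε : 0 < 1 - specMMPoint K F 2 := by linarith
  have hsU : max u₀ 1 ≤ c / (1 - t) := by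
    rw [le_div_iff₀ hs]
    have h' : 1 - t ≤ c / (2 * max u₀ 1) := by linarith
    have h'' := (le_div_iff₀ (by positivity : (0 : ℝ) < 2 * max u₀ 1)).1 h'
    nlinarith
  have hu0 : 0 < Real.log (specMMPoint K F 1 / (1 - specMMPoint K F 2)) := lt_trans (div_pos hc hs) hu
  have hl := hu₀ F hF hlt2 (by linarith)
  -- the log-aspect window `u < c'/(1−t)` (file 9, `violator_window`)
  have hw : Real.log (specMMPoint K F 1 / (1 - specMMPoint K F 2)) < c' / (1 - t) := by
    rw [lt_div_iff₀ hs]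
    have h5 : (1 - t) * specMMPoint K F 1 * Real.log (specMMPoint K F 1 / (1 - specMMPoint K F 2)) <
        c' * specMMPoint K F 1 := lt_of_lt_of_le (mul_lt_mul_of_pos_right hdark hu0) hl
    have h6 : specMMPoint K F 1 * (Real.log (specMMPoint K F 1 / (1 - specMMPoint K F 2)) * (1 - t)) <
        specMMPoint K F 1 * c' := by nlinarith
    exact lt_of_mul_lt_mul_left h6 hθ1.le
  refine ⟨hθ1, ?_, ?_, hdark, ?_⟩
  · -- not deeper: `u < c'/s`, i.e. `θ₁/ε₂ < exp(c'/s)`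
    have h7 : specMMPoint K F 1 / (1 - specMMPoint K F 2) < Real.exp (c' / (1 - t)) :=
      (Real.log_lt_iff_lt_exp (div_pos hθ1 hε)).1 hw
    have h8 := (div_lt_iff₀ hε).1 h7
    rw [Real.exp_neg, ← div_eq_mul_inv, div_lt_iff₀ (Real.exp_pos _)]
    linarith
  · -- deep: `R·ε₂ < θ₁`
    rw [Real.exp_neg, ← div_eq_mul_inv, lt_div_iff₀ (Real.exp_pos _)]
    linarith
  · -- not darker: `d·u ≤ c'θ₁ < c'θ₁·(s·u/c)`
    have h8 : 1 < (1 - t) * Real.log (specMMPoint K F 1 / (1 - specMMPoint K F 2)) / c :=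
      (one_lt_div hc).2 (by have := (div_lt_iff₀ hs).1 hu; linarith)
    have h9 : c' * specMMPoint K F 1 <
        c' * specMMPoint K F 1 * ((1 - t) * Real.log (specMMPoint K F 1 / (1 - specMMPoint K F 2)) / c) :=
      lt_mul_of_one_lt_right (mul_pos hc'0 hθ1) h8
    have h10 : (specMMPoint K F 0 + specMMPoint K F 1 + specMMPoint K F 2 - 2) *
        Real.log (specMMPoint K F 1 / (1 - specMMPoint K F 2)) <
          c' / c * ((1 - t) * specMMPoint K F 1) * Real.log (specMMPoint K F 1 / (1 - specMMPoint K F 2)) :=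
      calc _ ≤ c' * specMMPoint K F 1 := hl
        _ < c' * specMMPoint K F 1 *
              ((1 - t) * Real.log (specMMPoint K F 1 / (1 - specMMPoint K F 2)) / c) := h9
        _ = c' / c * ((1 - t) * specMMPoint K F 1) *
              Real.log (specMMPoint K F 1 / (1 - specMMPoint K F 2)) := by ring
    exact lt_of_mul_lt_mul_right h10 hu0.le

/-- ★ **EMPTY CELLS**: under a rate-`c'` law with `0 < c' ≤ c` the darkness cell `(1, c'/c)` is empty, so the clause
`(t, exp(c/(1−t)))` HOLDS for all `t ∈ [t₁,1)` — the monotone form of file 9's `roofClauses_of_modulus_exact`.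
[cite: Strassen1988, Thm. 3.8] [cite: CoppersmithWinograd1990, §8] -/
theorem no_violator_of_le {c' : ℝ} (hc'0 : 0 < c')
    (hlaw : ∃ u₀ : ℝ, ∀ F : SpectralMap K, IsUniversalSpectralPoint K F → specMMPoint K F 2 < 1 →
      u₀ ≤ Real.log (specMMPoint K F 1 / (1 - specMMPoint K F 2)) →
        (specMMPoint K F 0 + specMMPoint K F 1 + specMMPoint K F 2 - 2) *
            Real.log (specMMPoint K F 1 / (1 - specMMPoint K F 2)) ≤ c' * specMMPoint K F 1)
    {c : ℝ} (hcc' : c' ≤ c) :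
    ∃ t₁ : ℝ, t₁ < 1 ∧ ∀ t : ℝ, t₁ ≤ t → t < 1 → ∀ F : SpectralMap K, IsUniversalSpectralPoint K F →
      t * specMMPoint K F 1 ≤
        (1 - specMMPoint K F 0) + Real.exp (c / (1 - t)) * (1 - specMMPoint K F 2) := by
  have hc : 0 < c := lt_of_lt_of_le hc'0 hcc'
  obtain ⟨t₁, ht₁, h⟩ := violator_cell hc'0 hlaw hc
  refine ⟨t₁, ht₁, fun t ht ht1 F hF => ?_⟩
  by_contra hnot
  obtain ⟨hθ1, -, -, hd1, hd2⟩ := h t ht ht1 F hF hnot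
  have hs : 0 < 1 - t := by linarith
  have hq : c' / c ≤ 1 := (div_le_one hc).2 hcc'
  have hpos : 0 < (1 - t) * specMMPoint K F 1 := mul_pos hs hθ1
  nlinarith

/-! ## §2 The cell over `ℂ` at the certificates of record -/

/-- ★★ **THE VIOLATOR'S CELL OVER `ℂ`, OF RECORD**: for every `c > 0`, every `c' > c₂ = (5 log(5/4) + 3 log 2)/3`
(file 3: the rate-`c'` law over `ℂ` is a theorem) there is `t₁ < 1` such that every universal `φ` over `ℂ` violating the
clause `(t, R = exp(c/(1−t)))`, `t ∈ [t₁,1)`, has HEIGHT `0 < θ₁ < R^{−13/29} = exp(−(13/29)c/(1−t))` (route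
`FarEdgeDescent`'s rate of record, file 9), ASPECT `θ₁·R^{−c'/c} < 1−θ₂ < θ₁·R^{−1}` and DARKNESS
`(1−t)θ₁ < d < (c'/c)(1−t)θ₁`.  Letting `c' ↓ c₂`: a counterexample to the first owed clauses (`c ↑ c₂`) is a point of
aspect `R^{−1−o(1)}`, darkness `(c₂+o(1))·θ₁/log R`, height `< R^{−0.448}`. [cite: CoppersmithWinograd1990, §8]
[cite: Pan1984, Thm. 17.1] [cite: LottiRomani1983, Prop. 4.1] [cite: Strassen1988, Thm. 3.8] -/
theorem violator_cell_record {c c' : ℝ} (hc : 0 < c) (hc' : (5 * Real.log (5 / 4) + 3 * Real.log 2) / 3 < c') :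
    ∃ t₁ : ℝ, t₁ < 1 ∧ ∀ t : ℝ, t₁ ≤ t → t < 1 → ∀ F : SpectralMap ℂ, IsUniversalSpectralPoint ℂ F →
      ¬ (t * specMMPoint ℂ F 1 ≤
          (1 - specMMPoint ℂ F 0) + Real.exp (c / (1 - t)) * (1 - specMMPoint ℂ F 2)) →
        0 < specMMPoint ℂ F 1 ∧ specMMPoint ℂ F 1 < Real.exp (-(13 / 29 * c / (1 - t))) ∧
          specMMPoint ℂ F 1 * Real.exp (-(c' / (1 - t))) < 1 - specMMPoint ℂ F 2 ∧
          1 - specMMPoint ℂ F 2 < specMMPoint ℂ F 1 * Real.exp (-(c / (1 - t))) ∧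
          (1 - t) * specMMPoint ℂ F 1 < specMMPoint ℂ F 0 + specMMPoint ℂ F 1 + specMMPoint ℂ F 2 - 2 ∧
          specMMPoint ℂ F 0 + specMMPoint ℂ F 1 + specMMPoint ℂ F 2 - 2 <
            c' / c * ((1 - t) * specMMPoint ℂ F 1) := by
  obtain ⟨t₁, ht₁, hC⟩ := violator_cell (K := ℂ) (lt_trans classCeiling_pos hc')
    (modulus_above_classCeiling c' hc') hc
  obtain ⟨t₂, ht₂, hP⟩ := violator_profile_of_rateBeyond (K := ℂ) (θ := 13 / 29) (by norm_num)
    (rateBeyond_of_le_thirteen_twentyNinths ℂ le_rfl) hc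
  refine ⟨max t₁ t₂, max_lt ht₁ ht₂, fun t ht ht1 F hF hnot => ?_⟩
  obtain ⟨hθ1, ha1, ha2, hd1, hd2⟩ := hC t (le_trans (le_max_left _ _) ht) ht1 F hF hnot
  obtain ⟨-, -, -, -, hh, -, -⟩ := hP t (le_trans (le_max_right _ _) ht) ht1 F hF hnot
  exact ⟨hθ1, hh, ha1, ha2, hd1, hd2⟩

/-- ★ **The cell in ratio form** (over `ℂ`, of record): with `s = 1−t` and `u = log(θ₁/ε₂)`, a violator of the clause
`(t, e^{c/s})`, `t ∈ [t₁,1)`, has `c < s·u < c'` and `1 < d/(s·θ₁) < c'/c` for every `c' > c₂` — two intervals that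
shrink to the points `s·u = c₂`, `d = c₂·θ₁/u·(1+o(1))` as `c ↑ c₂`. [cite: CoppersmithWinograd1990, §8]
[cite: Strassen1988, Thm. 3.8] -/
theorem violator_ratios_record {c c' : ℝ} (hc : 0 < c) (hc' : (5 * Real.log (5 / 4) + 3 * Real.log 2) / 3 < c') :
    ∃ t₁ : ℝ, t₁ < 1 ∧ ∀ t : ℝ, t₁ ≤ t → t < 1 → ∀ F : SpectralMap ℂ, IsUniversalSpectralPoint ℂ F →
      ¬ (t * specMMPoint ℂ F 1 ≤
          (1 - specMMPoint ℂ F 0) + Real.exp (c / (1 - t)) * (1 - specMMPoint ℂ F 2)) →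
        c < (1 - t) * Real.log (specMMPoint ℂ F 1 / (1 - specMMPoint ℂ F 2)) ∧
          (1 - t) * Real.log (specMMPoint ℂ F 1 / (1 - specMMPoint ℂ F 2)) < c' ∧
          1 < (specMMPoint ℂ F 0 + specMMPoint ℂ F 1 + specMMPoint ℂ F 2 - 2) / ((1 - t) * specMMPoint ℂ F 1) ∧
          (specMMPoint ℂ F 0 + specMMPoint ℂ F 1 + specMMPoint ℂ F 2 - 2) / ((1 - t) * specMMPoint ℂ F 1)
            < c' / c := by
  obtain ⟨t₁, ht₁, hW⟩ := violator_window_classCeiling hc hc'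
  obtain ⟨t₂, ht₂, hC⟩ := violator_cell_record hc hc'
  refine ⟨max t₁ t₂, max_lt ht₁ ht₂, fun t ht ht1 F hF hnot => ?_⟩
  have hs : 0 < 1 - t := by linarith
  obtain ⟨hu, hw⟩ := hW t (le_trans (le_max_left _ _) ht) ht1 F hF hnot
  obtain ⟨hθ1, -, -, -, hd1, hd2⟩ := hC t (le_trans (le_max_right _ _) ht) ht1 F hF hnot
  have hpos : 0 < (1 - t) * specMMPoint ℂ F 1 := mul_pos hs hθ1
  refine ⟨?_, ?_, (one_lt_div hpos).2 hd1, (div_lt_iff₀ hpos).2 hd2⟩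
  · have := (div_lt_iff₀ hs).1 hu
    linarith
  · have := (lt_div_iff₀ hs).1 hw
    linarith

end Summit.MatrixMultiplication.MatrixMultiplication.Theorems.SaturationLadderViolatorCell

end
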